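import Mathlib
import Summits.CriticalPhenomena.CardyFormulaZ2.Theses.CardyWhiteToColoured
import Summits.CriticalPhenomena.CardyFormulaZ2.Theses.CardyUniqueLimit
import Literature.Probability.Percolation.SmoothedWhiteNoise
import Summits.CriticalPhenomena.CardyFormulaZ2.Theorems.CardyWhiteToColouredDriftBoundStubWhiteWindow
import Summits.CriticalPhenomena.CardyFormulaZ2.Theorems.CardyWhiteToColouredDriftBoundHardness
import Summits.CriticalPhenomena.CardyFormulaZ2.Theorems.CardyWhiteToColouredDriftBoundPlackettDefs
import Summits.CriticalPhenomena.CardyFormulaZ2.Theorems.CardyWhiteToColouredDriftBoundStubLocality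
import Summits.CriticalPhenomena.CardyFormulaZ2.Theorems.CardyWhiteToColouredDriftBoundStubRegLimit
import Summits.CriticalPhenomena.CardyFormulaZ2.Theorems.CardyWhiteToColouredDriftBoundStubDriftIdentity
import Summits.CriticalPhenomena.CardyFormulaZ2.Theorems.CardyWhiteToColouredDriftBoundStubDriftContinuous

/-!
# The open pair estimate of line `registered` is crux-sized: what it is equivalent to and what it implies

Helper file for the crux item `stmt-CriticalPhenomena-4596`
(`Summit.CriticalPhenomena.CardyFormulaZ2.Theses.CardyWhiteToColoured.DriftBound`, route
`CardyWhiteToColoured` of `CardyFormulaZ2`), line `registered` (`Cruxes/DriftBound/Lines/birth.lean`,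
skeleton v4.1, lead c3). After waves 2–3 of lead c3 the skeleton has ONE open stub, the pair estimate
`stub_pairEstimate` (S4): the integrated Plackett/Piterbarg pair functional
`∫_{σ₁}^{σ₂} plackettDrift I_δ A_δ η σ dσ` of the crossing event of `R_δ` is eventually (`η → 0⁺`)
`< ε`, uniformly over `1/(1+|log δ|) ≤ σ₁ ≤ σ₂ ≤ ℓ₀/δ`, `δ < δ₀`. No new statement is claimed here;
these are kernel-checked consequences of the LANDED stubs S0–S3 (`stub_locality` p163713,
`stub_driftIdentity` p165365 — the exact drift identity `d/dσ regFlow = plackettDrift` —,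
`stub_driftContinuous` p165326, `stub_regLimit` p164093) that size S4:

* `pe_window_of_plackett` (the skeleton's glue, here as a tree theorem) and `pe_pairEstimate_of_window`:
  **S4 is EQUIVALENT to the uniform Cauchy window W** of skeleton v3.2 (`|P^latt_{s₂,δ}(R) − P^latt_{s₁,δ}(R)| < ε`
  for `δ/(1+|log δ|) ≤ s₁ ≤ s₂ ≤ ℓ₀`, `δ < δ₀`): forward by the fundamental theorem of calculus in `σ`
  and the limit `η → 0⁺`; backward the same way, since `∫ plackettDrift = regFlow(σ₂) − regFlow(σ₁)`
  tends to `P(s₂) − P(s₁)`.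
* `pe_driftBound_of_pairEstimate`: with the landed white window B1 (`stub_whiteWindow`), S4 gives the
  crux `DriftBound` (this is the file that closes the crux the day S4 is proved).
* `pe_limitExists_of_pairEstimate`: hence S4 implies the open crux `CardyUniqueLimit.LimitExists`
  (stmt-CriticalPhenomena-0747: bond-`ℤ²` crossing probabilities of every conformal rectangle converge
  as the mesh tends to `0`), through `limitExists_of_driftBound` (p144970). So S4 is crux-sized
  (open-problem class), not lemma-sized; `pl_pairEstimate_hardness` records the three facts in one
  registered statement.

References: BeliaevMuirheadRivera2020 (Lemma 2.22 / Thm 2.14), GarbanPeteSchramm2013, KestenScalingCMP1987,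
Grimmett 1999 §9.7, SchrammSmirnov2011 §1.
-/

noncomputable section

namespace Summit.CriticalPhenomena.CardyFormulaZ2.Cruxes.DriftBound.Birth

open Set Filter Topology MeasureTheory
open Literature.Probability.LatticeModels Literature.Probability.Percolation
open Literature.Probability.RandomPlanarGeometry

/-- **The derivative form gives the window.** From locality/scaling (S0), the exact drift
identity (S1), continuity of the drift (S2), the regularisation limit (S3) and the pair estimate
(S4): for `δ < δ₀` and `δ/(1+|log δ|) ≤ s₁ ≤ s₂ ≤ ℓ₀`, with `σ_k = s_k/δ`,
`regFlow η σ₂ − regFlow η σ₁ = ∫_{σ₁}^{σ₂} plackettDrift η` (FTC) is eventually `< ε/2`, and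
letting `η → 0⁺` gives `|P(s₂) − P(s₁)| ≤ ε/2 < ε`. -/
theorem pe_window_of_plackett
    (hS0 : ∀ R : Literature.Probability.RandomPlanarGeometry.ConformalRectangle, ∀ δ : ℝ, 0 < δ → ∀ σ : ℝ, 0 < σ →
      Literature.Probability.Percolation.latticeWhiteNoise.real
          {ξ | {e : Sym2 (Literature.Probability.LatticeModels.Site 2) |
            e ∈ innerEdges R.carrier δ ∧ 0 < normNoise σ ξ (Literature.Probability.LatticeModels.medialPoint 1 e)} ∈
            Literature.Probability.Percolation.discreteCrossing R.carrier δ (R.arc 0) (R.arc 2)} =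
        Literature.Probability.Percolation.smoothedCrossingProb (σ * δ) δ R.carrier (R.arc 0) (R.arc 2))
    (hS1 : ∀ (I : Finset (Sym2 (Literature.Probability.LatticeModels.Site 2)))
      (A : Set (Set (Sym2 (Literature.Probability.LatticeModels.Site 2)))) (η σ : ℝ), 0 < η → 0 < σ →
      HasDerivAt (fun s : ℝ => regFlow I A η s) (plackettDrift I A η σ) σ)
    (hS2 : ∀ (I : Finset (Sym2 (Literature.Probability.LatticeModels.Site 2)))
      (A : Set (Set (Sym2 (Literature.Probability.LatticeModels.Site 2)))) (η : ℝ), 0 < η →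
      ContinuousOn (fun s : ℝ => plackettDrift I A η s) (Set.Ioi 0))
    (hS3 : ∀ (I : Finset (Sym2 (Literature.Probability.LatticeModels.Site 2)))
      (A : Set (Set (Sym2 (Literature.Probability.LatticeModels.Site 2)))) (σ : ℝ), 0 < σ →
      Filter.Tendsto (fun η : ℝ => regFlow I A η σ) (nhdsWithin 0 (Set.Ioi 0))
        (nhds (Literature.Probability.Percolation.latticeWhiteNoise.real
          {ξ | {e : Sym2 (Literature.Probability.LatticeModels.Site 2) |
            e ∈ I ∧ 0 < normNoise σ ξ (Literature.Probability.LatticeModels.medialPoint 1 e)} ∈ A})))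
    (hS4 : ∀ R : Literature.Probability.RandomPlanarGeometry.ConformalRectangle, ∀ ε : ℝ, 0 < ε →
      ∃ ℓ₀ : ℝ, 0 < ℓ₀ ∧ ∃ δ₀ : ℝ, 0 < δ₀ ∧ ∀ δ : ℝ, 0 < δ → δ < δ₀ →
        ∀ σ₁ σ₂ : ℝ, 1 / (1 + |Real.log δ|) ≤ σ₁ → σ₁ ≤ σ₂ → σ₂ * δ ≤ ℓ₀ →
          ∀ᶠ η : ℝ in nhdsWithin 0 (Set.Ioi 0),
            |∫ s in σ₁..σ₂, plackettDrift (innerEdges R.carrier δ)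
                (Literature.Probability.Percolation.discreteCrossing R.carrier δ (R.arc 0) (R.arc 2)) η s| < ε) :
    ∀ R : Literature.Probability.RandomPlanarGeometry.ConformalRectangle, ∀ ε : ℝ, 0 < ε →
      ∃ ℓ₀ : ℝ, 0 < ℓ₀ ∧ ∃ δ₀ : ℝ, 0 < δ₀ ∧ ∀ δ : ℝ, 0 < δ → δ < δ₀ →
        ∀ s₁ s₂ : ℝ, δ / (1 + |Real.log δ|) ≤ s₁ → s₁ ≤ s₂ → s₂ ≤ ℓ₀ →
          |Literature.Probability.Percolation.smoothedCrossingProb s₂ δ R.carrier (R.arc 0) (R.arc 2)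
            - Literature.Probability.Percolation.smoothedCrossingProb s₁ δ R.carrier (R.arc 0) (R.arc 2)| < ε := by
  intro R ε hε
  have hε2 : (0 : ℝ) < ε / 2 := by positivity
  obtain ⟨ℓ₀, hℓ₀, δ₀, hδ₀, H⟩ := hS4 R (ε / 2) hε2
  refine ⟨ℓ₀, hℓ₀, δ₀, hδ₀, fun δ hδ hδlt s₁ s₂ hs₁ hs₁₂ hs₂ => ?_⟩
  -- the inner edges and the crossing event at mesh `δ`
  set I : Finset (Sym2 (Site 2)) := innerEdges R.carrier δ with hI
  set A : Set (Set (Sym2 (Site 2))) := discreteCrossing R.carrier δ (R.arc 0) (R.arc 2) with hA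
  -- widths in lattice units
  set σ₁ : ℝ := s₁ / δ with hσ₁
  set σ₂ : ℝ := s₂ / δ with hσ₂
  have hlog : (0 : ℝ) < 1 + |Real.log δ| := by positivity
  have hcut : 0 < δ / (1 + |Real.log δ|) := div_pos hδ hlog
  have hs₁pos : 0 < s₁ := hcut.trans_le hs₁
  have hσ₁pos : 0 < σ₁ := div_pos hs₁pos hδ
  have hσ₁le : 1 / (1 + |Real.log δ|) ≤ σ₁ := by
    rw [hσ₁, le_div_iff₀ hδ, div_mul_eq_mul_div, one_mul]
    exact hs₁
  have hσ₁₂ : σ₁ ≤ σ₂ := div_le_div_of_nonneg_right hs₁₂ hδ.le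
  have hσ₂ℓ : σ₂ * δ ≤ ℓ₀ := by
    rw [hσ₂, div_mul_cancel₀ s₂ hδ.ne']
    exact hs₂
  have hσpos : ∀ σ ∈ uIcc σ₁ σ₂, 0 < σ := by
    intro σ hσ
    rw [uIcc_of_le hσ₁₂] at hσ
    exact hσ₁pos.trans_le hσ.1
  -- (S4) the integrated pair functional is eventually small
  have hev := H δ hδ hδlt σ₁ σ₂ hσ₁le hσ₁₂ hσ₂ℓ
  -- (S1)+(S2): FTC, `regFlow η σ₂ − regFlow η σ₁ = ∫ plackettDrift η`
  have hftc : ∀ η : ℝ, 0 < η →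
      ∫ s in σ₁..σ₂, plackettDrift I A η s = regFlow I A η σ₂ - regFlow I A η σ₁ := by
    intro η hη
    refine intervalIntegral.integral_eq_sub_of_hasDerivAt (fun σ hσ => hS1 I A η σ hη (hσpos σ hσ)) ?_
    refine ContinuousOn.intervalIntegrable ?_
    exact (hS2 I A η hη).mono fun σ hσ => hσpos σ hσ
  have hev' : ∀ᶠ η : ℝ in 𝓝[>] 0, |regFlow I A η σ₂ - regFlow I A η σ₁| ≤ ε / 2 := by
    filter_upwards [hev, self_mem_nhdsWithin] with η h hηpos
    rw [← hftc η hηpos]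
    exact h.le
  -- (S3) let `η → 0⁺`
  set L : ℝ → ℝ := fun σ => latticeWhiteNoise.real
    {ξ | {e : Sym2 (Site 2) | e ∈ I ∧ 0 < normNoise σ ξ (medialPoint 1 e)} ∈ A} with hL
  have hlim : Tendsto (fun η : ℝ => |regFlow I A η σ₂ - regFlow I A η σ₁|) (𝓝[>] 0)
      (𝓝 |L σ₂ - L σ₁|) :=
    ((hS3 I A σ₂ (hσ₁pos.trans_le hσ₁₂)).sub (hS3 I A σ₁ hσ₁pos)).abs
  have hle : |L σ₂ - L σ₁| ≤ ε / 2 := le_of_tendsto hlim hev'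
  -- (S0) the limits are the crux's lattice terms
  have h₁ : L σ₁ = smoothedCrossingProb s₁ δ R.carrier (R.arc 0) (R.arc 2) := by
    have := hS0 R δ hδ σ₁ hσ₁pos
    rw [hσ₁, div_mul_cancel₀ s₁ hδ.ne'] at this
    exact this
  have h₂ : L σ₂ = smoothedCrossingProb s₂ δ R.carrier (R.arc 0) (R.arc 2) := by
    have := hS0 R δ hδ σ₂ (hσ₁pos.trans_le hσ₁₂)
    rw [hσ₂, div_mul_cancel₀ s₂ hδ.ne'] at this
    exact this
  rw [← h₁, ← h₂]
  exact hle.trans_lt (half_lt_self hε)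


/-- The cut scale `s⋆ = δ/(1 + |log δ|)` of the white window is positive and at most `δ`. -/
theorem pe_cutScale_pos_le {δ : ℝ} (hδ : 0 < δ) :
    0 < δ / (1 + |Real.log δ|) ∧ δ / (1 + |Real.log δ|) ≤ δ := by
  have h1 : (1 : ℝ) ≤ 1 + |Real.log δ| := le_add_of_nonneg_right (abs_nonneg _)
  have hpos : (0 : ℝ) < 1 + |Real.log δ| := one_pos.trans_le h1
  exact ⟨div_pos hδ hpos, div_le_self hδ.le h1⟩

/-- **Assembly of the line (v3.2, verbatim)**: the white window B1 and the uniform Cauchy window W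
give the crux `DriftBound`. -/
theorem pe_driftBound_of_window
    (hB1 : ∀ R : Literature.Probability.RandomPlanarGeometry.ConformalRectangle, ∀ ε : ℝ, 0 < ε →
      ∃ δ₀ : ℝ, 0 < δ₀ ∧ ∀ δ : ℝ, 0 < δ → δ < δ₀ → ∀ s : ℝ, 0 < s → s ≤ δ / (1 + |Real.log δ|) →
        |Literature.Probability.Percolation.smoothedCrossingProb s δ R.carrier (R.arc 0) (R.arc 2)
          - Literature.Probability.Percolation.bondDomainCrossingProb R δ| < ε)
    (hW : ∀ R : Literature.Probability.RandomPlanarGeometry.ConformalRectangle, ∀ ε : ℝ, 0 < ε →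
      ∃ ℓ₀ : ℝ, 0 < ℓ₀ ∧ ∃ δ₀ : ℝ, 0 < δ₀ ∧ ∀ δ : ℝ, 0 < δ → δ < δ₀ →
        ∀ s₁ s₂ : ℝ, δ / (1 + |Real.log δ|) ≤ s₁ → s₁ ≤ s₂ → s₂ ≤ ℓ₀ →
          |Literature.Probability.Percolation.smoothedCrossingProb s₂ δ R.carrier (R.arc 0) (R.arc 2)
            - Literature.Probability.Percolation.smoothedCrossingProb s₁ δ R.carrier (R.arc 0) (R.arc 2)| < ε) :
    Summit.CriticalPhenomena.CardyFormulaZ2.Theses.CardyWhiteToColoured.DriftBound := by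
  intro R ε hε
  have hε2 : (0 : ℝ) < ε / 2 := by positivity
  obtain ⟨ℓ₀, hℓ₀, δ₁, hδ₁, hW⟩ := hW R (ε / 2) hε2
  obtain ⟨δ₂, hδ₂, hB1⟩ := hB1 R (ε / 2) hε2
  refine ⟨ℓ₀, hℓ₀, fun ℓ hℓ hℓℓ₀ => ?_⟩
  refine ⟨min (min δ₁ δ₂) ℓ, lt_min (lt_min hδ₁ hδ₂) hℓ, fun δ hδ hδlt => ?_⟩
  have hδ₁' : δ < δ₁ := lt_of_lt_of_le hδlt ((min_le_left _ _).trans (min_le_left _ _))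
  have hδ₂' : δ < δ₂ := lt_of_lt_of_le hδlt ((min_le_left _ _).trans (min_le_right _ _))
  have hδℓ : δ < ℓ := lt_of_lt_of_le hδlt (min_le_right _ _)
  obtain ⟨hspos, hsle⟩ := pe_cutScale_pos_le hδ
  set s := δ / (1 + |Real.log δ|) with hs
  have hsℓ : s ≤ ℓ := hsle.trans hδℓ.le
  have h2 : |smoothedCrossingProb ℓ δ R.carrier (R.arc 0) (R.arc 2)
      - smoothedCrossingProb s δ R.carrier (R.arc 0) (R.arc 2)| < ε / 2 :=
    hW δ hδ hδ₁' s ℓ le_rfl hsℓ hℓℓ₀.le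
  have h1 : |smoothedCrossingProb s δ R.carrier (R.arc 0) (R.arc 2)
      - bondDomainCrossingProb R δ| < ε / 2 :=
    hB1 δ hδ hδ₂' s hspos le_rfl
  have h : |bondDomainCrossingProb R δ
      - smoothedCrossingProb ℓ δ R.carrier (R.arc 0) (R.arc 2)| < ε := by
    have := abs_sub_lt_iff.1 h1
    have := abs_sub_lt_iff.1 h2
    rw [abs_sub_lt_iff]
    constructor <;> linarith
  rw [smoothedCrossingProb_conformalRectangle_eq] at h
  exact h

/-- **The window gives back the pair estimate** (converse of `pe_window_of_plackett`, from the
landed S0–S3): if the uniform Cauchy window W holds then, for `δ < δ₀` and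
`1/(1+|log δ|) ≤ σ₁ ≤ σ₂ ≤ ℓ₀/δ`, `∫_{σ₁}^{σ₂} plackettDrift η = regFlow η σ₂ − regFlow η σ₁` (FTC, S1+S2)
tends as `η → 0⁺` (S3) to `P(σ₂δ) − P(σ₁δ)` (S0), whose absolute value is `< ε`; so the integral is
eventually `< ε` in absolute value. -/
theorem pe_pairEstimate_of_window
    (hW : ∀ R : Literature.Probability.RandomPlanarGeometry.ConformalRectangle, ∀ ε : ℝ, 0 < ε → ∃ ℓ₀ : ℝ, 0 < ℓ₀ ∧ ∃ δ₀ : ℝ, 0 < δ₀ ∧ ∀ δ : ℝ, 0 < δ → δ < δ₀ → ∀ s₁ s₂ : ℝ, δ / (1 + |Real.log δ|) ≤ s₁ → s₁ ≤ s₂ → s₂ ≤ ℓ₀ → |Literature.Probability.Percolation.smoothedCrossingProb s₂ δ R.carrier (R.arc 0) (R.arc 2) - Literature.Probability.Percolation.smoothedCrossingProb s₁ δ R.carrier (R.arc 0) (R.arc 2)| < ε) :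
    ∀ R : Literature.Probability.RandomPlanarGeometry.ConformalRectangle, ∀ ε : ℝ, 0 < ε → ∃ ℓ₀ : ℝ, 0 < ℓ₀ ∧ ∃ δ₀ : ℝ, 0 < δ₀ ∧ ∀ δ : ℝ, 0 < δ → δ < δ₀ → ∀ σ₁ σ₂ : ℝ, 1 / (1 + |Real.log δ|) ≤ σ₁ → σ₁ ≤ σ₂ → σ₂ * δ ≤ ℓ₀ → ∀ᶠ η : ℝ in nhdsWithin 0 (Set.Ioi 0), |∫ s in σ₁..σ₂, plackettDrift (innerEdges R.carrier δ) (Literature.Probability.Percolation.discreteCrossing R.carrier δ (R.arc 0) (R.arc 2)) η s| < ε := by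
  intro R ε hε
  obtain ⟨ℓ₀, hℓ₀, δ₀, hδ₀, H⟩ := hW R ε hε
  refine ⟨ℓ₀, hℓ₀, δ₀, hδ₀, fun δ hδ hδlt σ₁ σ₂ hσ₁ hσ₁₂ hσ₂ => ?_⟩
  set I : Finset (Sym2 (Site 2)) := innerEdges R.carrier δ with hI
  set A : Set (Set (Sym2 (Site 2))) := discreteCrossing R.carrier δ (R.arc 0) (R.arc 2) with hA
  have hlog : (0 : ℝ) < 1 + |Real.log δ| := by positivity
  have hσ₁pos : 0 < σ₁ := (div_pos one_pos hlog).trans_le hσ₁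
  have hσpos : ∀ σ ∈ uIcc σ₁ σ₂, 0 < σ := by
    intro σ hσ
    rw [uIcc_of_le hσ₁₂] at hσ
    exact hσ₁pos.trans_le hσ.1
  -- the physical widths `s_k = σ_k δ` are in the window
  have hs₁ : δ / (1 + |Real.log δ|) ≤ σ₁ * δ := by
    have := mul_le_mul_of_nonneg_right hσ₁ hδ.le
    rwa [div_mul_eq_mul_div, one_mul] at this
  have hs₁₂ : σ₁ * δ ≤ σ₂ * δ := mul_le_mul_of_nonneg_right hσ₁₂ hδ.le
  have hwin : |smoothedCrossingProb (σ₂ * δ) δ R.carrier (R.arc 0) (R.arc 2)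
      - smoothedCrossingProb (σ₁ * δ) δ R.carrier (R.arc 0) (R.arc 2)| < ε :=
    H δ hδ hδlt (σ₁ * δ) (σ₂ * δ) hs₁ hs₁₂ hσ₂
  -- FTC at every `η > 0`
  have hftc : ∀ η : ℝ, 0 < η →
      ∫ s in σ₁..σ₂, plackettDrift I A η s = regFlow I A η σ₂ - regFlow I A η σ₁ := by
    intro η hη
    refine intervalIntegral.integral_eq_sub_of_hasDerivAt
      (fun σ hσ => stub_driftIdentity I A η σ hη (hσpos σ hσ)) ?_
    exact ContinuousOn.intervalIntegrable ((stub_driftContinuous I A η hη).mono fun σ hσ => hσpos σ hσ)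
  -- the limit of the integral as `η → 0⁺`
  set L : ℝ → ℝ := fun σ => latticeWhiteNoise.real
    {ξ | {e : Sym2 (Site 2) | e ∈ I ∧ 0 < normNoise σ ξ (medialPoint 1 e)} ∈ A} with hL
  have hlim : Tendsto (fun η : ℝ => |∫ s in σ₁..σ₂, plackettDrift I A η s|) (𝓝[>] 0)
      (𝓝 |L σ₂ - L σ₁|) := by
    have h := ((stub_regLimit I A σ₂ (hσ₁pos.trans_le hσ₁₂)).sub (stub_regLimit I A σ₁ hσ₁pos)).abs
    refine h.congr' ?_
    filter_upwards [self_mem_nhdsWithin] with η hη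
    rw [hftc η hη]
  have h₁ : L σ₁ = smoothedCrossingProb (σ₁ * δ) δ R.carrier (R.arc 0) (R.arc 2) := stub_locality R δ hδ σ₁ hσ₁pos
  have h₂ : L σ₂ = smoothedCrossingProb (σ₂ * δ) δ R.carrier (R.arc 0) (R.arc 2) :=
    stub_locality R δ hδ σ₂ (hσ₁pos.trans_le hσ₁₂)
  rw [h₁, h₂] at hlim
  exact (tendsto_order.1 hlim).2 ε hwin

/-- **S4 closes the crux** (with the landed white window B1 and the landed S0–S3): the file-level
form of the skeleton's composition `driftBound_of_stubs`, to be fed `stub_pairEstimate` the day it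
is proved. -/
theorem pe_driftBound_of_pairEstimate
    (hS4 : ∀ R : Literature.Probability.RandomPlanarGeometry.ConformalRectangle, ∀ ε : ℝ, 0 < ε → ∃ ℓ₀ : ℝ, 0 < ℓ₀ ∧ ∃ δ₀ : ℝ, 0 < δ₀ ∧ ∀ δ : ℝ, 0 < δ → δ < δ₀ → ∀ σ₁ σ₂ : ℝ, 1 / (1 + |Real.log δ|) ≤ σ₁ → σ₁ ≤ σ₂ → σ₂ * δ ≤ ℓ₀ → ∀ᶠ η : ℝ in nhdsWithin 0 (Set.Ioi 0), |∫ s in σ₁..σ₂, plackettDrift (innerEdges R.carrier δ) (Literature.Probability.Percolation.discreteCrossing R.carrier δ (R.arc 0) (R.arc 2)) η s| < ε) :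
    Summit.CriticalPhenomena.CardyFormulaZ2.Theses.CardyWhiteToColoured.DriftBound :=
  pe_driftBound_of_window stub_whiteWindow
    (pe_window_of_plackett stub_locality stub_driftIdentity stub_driftContinuous stub_regLimit hS4)

/-- **S4 is crux-sized**: it implies the open crux `CardyUniqueLimit.LimitExists` — the bond-`ℤ²`
crossing probabilities of every conformal rectangle converge as the mesh tends to `0` — through
`DriftBound` and the landed certificate `limitExists_of_driftBound`. -/
theorem pe_limitExists_of_pairEstimate
    (hS4 : ∀ R : Literature.Probability.RandomPlanarGeometry.ConformalRectangle, ∀ ε : ℝ, 0 < ε → ∃ ℓ₀ : ℝ, 0 < ℓ₀ ∧ ∃ δ₀ : ℝ, 0 < δ₀ ∧ ∀ δ : ℝ, 0 < δ → δ < δ₀ → ∀ σ₁ σ₂ : ℝ, 1 / (1 + |Real.log δ|) ≤ σ₁ → σ₁ ≤ σ₂ → σ₂ * δ ≤ ℓ₀ → ∀ᶠ η : ℝ in nhdsWithin 0 (Set.Ioi 0), |∫ s in σ₁..σ₂, plackettDrift (innerEdges R.carrier δ) (Literature.Probability.Percolation.discreteCrossing R.carrier δ (R.arc 0) (R.arc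 2)) η s| < ε) :
    Summit.CriticalPhenomena.CardyFormulaZ2.Theses.CardyUniqueLimit.LimitExists :=
  Summit.CriticalPhenomena.CardyFormulaZ2.Theorems.WhiteToColoured.limitExists_of_driftBound
    (pe_driftBound_of_pairEstimate hS4)

/-- **Hardness of the pair estimate (registered form).** The open stub S4 of line `registered` is
(i) equivalent to the uniform Cauchy window W of skeleton v3.2, (ii) sufficient for the crux
`DriftBound`, and (iii) sufficient for the open crux `CardyUniqueLimit.LimitExists` — all through the
landed stubs S0–S3 and the landed white window. Fully qualified one-line statement registered as a
sub-goal stub of the crux item. -/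
theorem pl_pairEstimate_hardness : ((∀ R : Literature.Probability.RandomPlanarGeometry.ConformalRectangle, ∀ ε : ℝ, 0 < ε → ∃ ℓ₀ : ℝ, 0 < ℓ₀ ∧ ∃ δ₀ : ℝ, 0 < δ₀ ∧ ∀ δ : ℝ, 0 < δ → δ < δ₀ → ∀ σ₁ σ₂ : ℝ, 1 / (1 + |Real.log δ|) ≤ σ₁ → σ₁ ≤ σ₂ → σ₂ * δ ≤ ℓ₀ → ∀ᶠ η : ℝ in nhdsWithin 0 (Set.Ioi 0), |∫ s in σ₁..σ₂, Summit.CriticalPhenomena.CardyFormulaZ2.Cruxes.DriftBound.Birth.plackettDrift (Summit.CriticalPhenomena.CardyFormulaZ2.Cruxes.DriftBound.Birth.innerEdges R.carrier δ) (Literature.Probability.Percolation.discreteCrossing R.carrier δ (R.arc 0) (R.arc 2)) η s| < ε) ↔ (∀ R : Literature.Probability.RandomPlanarGeometry.ConformalRectangle, ∀ ε : ℝ, 0 < ε → ∃ ℓ₀ : ℝ, 0 < ℓ₀ ∧ ∃ δ₀ : ℝ, 0 < δ₀ ∧ ∀ δ : ℝ, 0 < δ → δ < δ₀ → ∀ s₁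 s₂ : ℝ, δ / (1 + |Real.log δ|) ≤ s₁ → s₁ ≤ s₂ → s₂ ≤ ℓ₀ → |Literature.Probability.Percolation.smoothedCrossingProb s₂ δ R.carrier (R.arc 0) (R.arc 2) - Literature.Probability.Percolation.smoothedCrossingProb s₁ δ R.carrier (R.arc 0) (R.arc 2)| < ε)) ∧ ((∀ R : Literature.Probability.RandomPlanarGeometry.ConformalRectangle, ∀ ε : ℝ, 0 < ε → ∃ ℓ₀ : ℝ, 0 < ℓ₀ ∧ ∃ δ₀ : ℝ, 0 < δ₀ ∧ ∀ δ : ℝ, 0 < δ → δ < δ₀ → ∀ σ₁ σ₂ : ℝ, 1 / (1 + |Real.log δ|) ≤ σ₁ → σ₁ ≤ σ₂ → σ₂ * δ ≤ ℓ₀ → ∀ᶠ η : ℝ in nhdsWithin 0 (Set.Ioi 0), |∫ s in σ₁..σ₂, Summit.CriticalPhenomena.CardyFormulaZ2.Cruxes.DriftBound.Birth.plackettDrift (Summit.CriticalPhenomena.CardyFormulaZ2.Cruxes.DriftBound.Birth.innerEdges R.carrier δ) (Literature.Probability.Percolation.discreteCrossing R.carrier δ (R.arc 0) (R.arc 2))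 η s| < ε) → Summit.CriticalPhenomena.CardyFormulaZ2.Theses.CardyWhiteToColoured.DriftBound) ∧ ((∀ R : Literature.Probability.RandomPlanarGeometry.ConformalRectangle, ∀ ε : ℝ, 0 < ε → ∃ ℓ₀ : ℝ, 0 < ℓ₀ ∧ ∃ δ₀ : ℝ, 0 < δ₀ ∧ ∀ δ : ℝ, 0 < δ → δ < δ₀ → ∀ σ₁ σ₂ : ℝ, 1 / (1 + |Real.log δ|) ≤ σ₁ → σ₁ ≤ σ₂ → σ₂ * δ ≤ ℓ₀ → ∀ᶠ η : ℝ in nhdsWithin 0 (Set.Ioi 0), |∫ s in σ₁..σ₂, Summit.CriticalPhenomena.CardyFormulaZ2.Cruxes.DriftBound.Birth.plackettDrift (Summit.CriticalPhenomena.CardyFormulaZ2.Cruxes.DriftBound.Birth.innerEdges R.carrier δ) (Literature.Probability.Percolation.discreteCrossing R.carrier δ (R.arc 0) (R.arc 2)) η s| < ε) → Summit.CriticalPhenomena.CardyFormulaZ2.Theses.CardyUniqueLimit.LimitExists) :=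
  ⟨⟨fun h => pe_window_of_plackett stub_locality stub_driftIdentity stub_driftContinuous stub_regLimit h,
    pe_pairEstimate_of_window⟩, pe_driftBound_of_pairEstimate, pe_limitExists_of_pairEstimate⟩

end Summit.CriticalPhenomena.CardyFormulaZ2.Cruxes.DriftBound.Birth

end
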